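/-
Copyright (c) 2026 the pub-hodgecm-mathlib formalisation cell (harness21).  Prover seat hodgecm-mathlib-LH4-p07 (g9), req620 Track A «(D-RAM) FOUR-FRAME» squad
(STAGE-1b, row-(2) lineage; dealer LH4-plan (g13) WORD #58 RULING A: «the two-literal census law of `lev_{a,m}` = LH4-p07 (g9)»), 2026-09-04.
-/
import Summits.HodgeConjecture.HodgeConjecture.Theorems.F0P3cDyRamJointProfileCensusGuardedUnr      -- ★ p859278 (LH4-p07 (g8)): `…_orderForm_guarded` (M∕E unramified)
import Summits.HodgeConjecture.HodgeConjecture.Theorems.F0P3cDyRamJointProfileCensusGuardedRamM     -- ★ p859305 (LH4-p07 (g8)): `…_orderForm_guarded_ramified` (M∕E ramified)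
import Summits.HodgeConjecture.HodgeConjecture.Theorems.F0P3cDyRamJointProfileCensusGuardLetter      -- ★ p859341 (LH4-p07 (g8)): GUARD LETTER `v_twist_depth_sub_twist_sq_eq`
import Summits.HodgeConjecture.HodgeConjecture.Theorems.F0P3cDyRamJointProfileCensusAxisTables       -- ★ p859438 (LH4-p07 (g8)): §1 `sum_ite_isOrd₃_eq_sum_range`; brings ★ (α) `isOrd_pow_iff_le`
import Summits.HodgeConjecture.HodgeConjecture.Theorems.F0P3cDyRamToricLevelCensusRamM               -- ★ `v_sub_map_eq_exp_of_datum` (RamM datum letter)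
import HarnessLib

/-!
# Crux `H413`, line LH4 «(D-RAM) FOUR-FRAME» — STAGE-1b, row (2): (T5-P-cut) «THE LEVEL-PIECE CENSUS AS A DOUBLY TRUNCATED ONE-MULTIPLIER ORDER FORM»
# `cnt(lev_{a′,b′}) = Σ_{j ≤ J′} #levelSet(j,0) + Σ_{b=1}^{R} Σ_{j ≤ J′} [j + b + nν ≤ m₂ + jl]·Σᶠ_{Λ ∈ levelSetDep(j,b;μ₁)} f b j Λ`,  `J′ = min(jl − a′, jl + n − b′)`

Cell `hodgecm-mathlib` (D-0151), FLOOR 0, crux item H413 = `stmt-HodgeConjecture-24833`, route of record `HCCMUnconditional`; squad F0∕P3c∕LH4; lane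
`--supports stmt-HodgeConjecture-24833 --as helper` (count-neutral; pays NO tier-0 row).  THEOREMS ONLY (no `def`, no instance, no notation, no `sorry`, default heartbeats).
OWNER'S ORGAN №1 for the END `levels_typeTwo_censusLaw` (= `hLaw` of ★ p859606; dealer WORD #58 RULING A; scope `F0/P3c/LH4/LH4-p07/g9/SCOPE-T5P-cone.v1.LH4p07g9.md`).

THE OBJECT.  ★ p859278 ∕ ★ p859305 (this lineage, g8) put the `G`-side census of a template piece `lev_{a′,b′}` at one literal `Γ = endoGL (γ₂, u)` into an order form whose
summands carry (i) the three-clause indicator `[IsOrd_j lam ∧ IsOrd_j ((jE c)⁻¹(lam−1)) ∧ IsOrd_j ((jE c′)⁻¹(lam−1)²)]` and (ii) the lattice-free GUARD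
`[j + b ≤ m₂ ∨ |ρμ₁∕μ₁ − ρμ₂∕μ₂| ≤ exp(…)]` in front of the ONE-multiplier cone cells `levelSetDep(j,b;μ₁)`, `μ₁ = (jE c)⁻¹(lam − jE u₀₀)` (branch `m₁ ≤ m₂`: the depth
multiplier is the shallower — the branch of every neighbourhood of `1`, where `nν → ∞`).  THIS FILE removes both indicators in favour of TOKENS of the element:
* §1 (type-free letters) `add_sub_two_sub_map_eq` (`ν − ρν = lam − ρlam` for `ν = lam + jE u₀₀ − 2`), `v_sub_map_le` (`|z − ρz| ≤ |z|`), and the two readings of the guard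
  as a CUTOFF: `guard_iff_cutoff_unr` — M∕E unramified tokens (`|jE ϖ| = exp(−1)`, `|α − ρα| = 1`, `|ν| = |jE ϖ|^{nν}`): `GUARD(j,b) ⟺ j + b + nν ≤ m₂ + jl`;
  `guard_iff_cutoff_ramM` — ramified tokens (`|jE ϖ| = exp(−2)`, `|α − ρα| = exp(−d_ρ)`, `|ν| = exp(−kν)`): `GUARD(j,b) ⟺ j + b ≤ m₂ ∨ 2(j+b) + kν ≤ 2m₂ + 2jl`.
* §2 the two censuses with (i) every summand TRUNCATED at `J′ = min(jl − a′, jl + n − b′)` (★ p859438 `sum_ite_isOrd₃_eq_sum_range`, the conductor tokens of `μ₁` and of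
  `μ₂ = (jE c′)⁻¹(lam − ρlam… )`: `μ₂ − ρμ₂ = (jE c′)⁻¹(lam − ρlam)(lam + ρlam − 2)`) and (ii) the guard replaced by the cutoff (★ p859341 `v_twist_depth_sub_twist_sq_eq` ∘ §1):
  `ncard_fixed_selfDual_endoGL_lev_sq_eq_orderForm_cutoff` (M∕E unramified) and `…_cutoff_ramified`.  The weights `f` stay abstract (★ (β) `finsum_levelSetDep_weight_eq_pow_mul_ncard`
  sums them cell by cell once stated for the multiplier `μ₁` — organ (β′) of the scope).
READING.  In tokens `(m₁, jl₁) = (m − a′, jl − a′)` of `μ₁` the level-piece census is the UNIT-type one-multiplier census (★ T5s currency) with the rows capped at `J′` and the cone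
cells capped along the diagonal `j + b ≤ m₂ + jl − nν = m + jl − b′` — the two caps the level-piece WELD (T5-P-coneΔ) has to carry; nothing else distinguishes `lev_{a′,b′}` from the unit.
HONEST LABEL.  Count-neutral lattice bookkeeping over ★ organs; nothing printed is asserted; no census law is stated; `HC_CM` is proved only modulo the 7 printed citations (2 remaining
named inputs: hLiu418 = `stmt-HodgeConjecture-24832`, h413 = `stmt-HodgeConjecture-24833`) until rung 0 closes.

## References
* [Kottwitz1986BaseChangeUnits] R. E. Kottwitz, *Base change for unit elements of Hecke algebras*, Compositio Math. 60 (1986): §1 pp. 240–241.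
* [Jacobowitz1962] R. Jacobowitz, *Hermitian forms over local fields*, Amer. J. Math. 84 (1962): §4.
* [Serre1979] J.-P. Serre, *Local Fields*, GTM 67 (1979): Ch. II §1 (ultrametric balls nested or disjoint); Ch. III §6 Prop. 12; Ch. IV §1.
* [Flicker1998UnitaryFL] Y. Z. Flicker, *Elementary proof of the fundamental lemma for a unitary group*, Canad. J. Math. 50 (1998): Prop. 7 p. 84 (the level tables).
-/

set_option autoImplicit false

noncomputable section

open scoped Valued WithZero Matrix MatrixGroups
open WithZero
open scoped Classical
open Literature.NumberTheory.Automorphic Literature.NumberTheory.Automorphic.HermitianLattice Literature.NumberTheory.Automorphic.UnitaryLatticeTree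
open Literature.NumberTheory.Rogawski1990
open Literature.NumberTheory.Automorphic.EllipticPlaneAsFieldLine
open Literature.NumberTheory.Automorphic.UnitaryThreeFourFrame (IsRamifiedQuadraticDatum)
open Literature.NumberTheory.LocalFields.QuadraticOrder
open Summit.HodgeConjecture.HodgeConjecture.Cruxes.H413.F0P3cDyRamToricCensusDefs
open Summit.HodgeConjecture.HodgeConjecture.Cruxes.H413.F0P3cDyRamOrderFiltrationRange (isOrd_pow_iff_le)
open Summit.HodgeConjecture.HodgeConjecture.Cruxes.H413.F0P3cDyRamToricLevelCensusRamM (v_sub_map_eq_exp_of_datum)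
open Summit.HodgeConjecture.HodgeConjecture.Cruxes.H413.F0P3cDyRamWSideOrderCensus
open Summit.HodgeConjecture.HodgeConjecture.Cruxes.H413.F0P3cDyRamConeLevelTransport
open Summit.HodgeConjecture.HodgeConjecture.Cruxes.H413.F0P3cDyRamBlockGlueCount
open Summit.HodgeConjecture.HodgeConjecture.Cruxes.H413.F0P3cDyRamBlockGluePlane
open Summit.HodgeConjecture.HodgeConjecture.Cruxes.H413.F0P3cDyRamBlockCensusOrderForm
open Summit.HodgeConjecture.HodgeConjecture.Cruxes.H413.F0P3cDyRamBlockCensusOrderFormJointProfile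
open Summit.HodgeConjecture.HodgeConjecture.Cruxes.H413.F0P3cDyRamJointProfileCensusGuardedUnr
open Summit.HodgeConjecture.HodgeConjecture.Cruxes.H413.F0P3cDyRamJointProfileCensusGuardedRamM
open Summit.HodgeConjecture.HodgeConjecture.Cruxes.H413.F0P3cDyRamJointProfileCensusGuardLetter
open Summit.HodgeConjecture.HodgeConjecture.Cruxes.H413.F0P3cDyRamJointProfileCensusAxisTables

namespace Summit.HodgeConjecture.HodgeConjecture.Cruxes.H413.F0P3cDyRamJointProfileCensusCutoff

/-! ## §1 Type-free letters: the guard as a cutoff in tokens -/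

section Letters

variable {K : Type} [Field K] [Valued K ℤᵐ⁰] {ρ : K →+* K}

omit [Valued K ℤᵐ⁰] in
/-- `ν − ρν = lam − ρlam` for `ν = lam + t − 2` with `t` `ρ`-fixed (the middle entry `jE u₀₀`). [cite: Kottwitz1986BaseChangeUnits, §1 pp. 240–241] -/
theorem add_sub_two_sub_map_eq {lam t : K} (hρt : ρ t = t) : (lam + t - 2) - ρ (lam + t - 2) = lam - ρ lam := by
  rw [map_sub, map_add, hρt, map_ofNat]; ring

/-- `|z − ρz| ≤ |z|` for an isometric `ρ`. [cite: Serre1979, Ch. II §1] -/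
theorem v_sub_map_le (hvρ : ∀ x, Valued.v (ρ x) = Valued.v x) (z : K) : Valued.v (z - ρ z) ≤ Valued.v z :=
  (Valuation.map_sub _ _ _).trans (by rw [hvρ, max_self])

/-- **THE GUARD IS A CUTOFF, M∕E UNRAMIFIED TOKENS**: `|ϖE| = exp(−1)`, `|dα| = 1`, `|x| = |ϖE|^{jl}|dα|` (`x = ν − ρν`), `|y| = |ϖE|^{nν}` (`y = ν`), `|x| ≤ |y|`:
`(j + b ≤ m₂ ∨ |x|∕|y| ≤ exp(−((j+b) − m₂))) ⟺ j + b + nν ≤ m₂ + jl`. [cite: Serre1979, Ch. II §1] -/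
theorem guard_iff_cutoff_unr {ϖE dα x y : K} (hϖE : Valued.v ϖE = exp (-1 : ℤ)) (hdα : Valued.v dα = 1) {jl nν : ℕ}
    (hx : Valued.v x = Valued.v ϖE ^ jl * Valued.v dα) (hy : Valued.v y = Valued.v ϖE ^ nν) (hxy : Valued.v x ≤ Valued.v y) (j b m₂ : ℕ) :
    (j + b ≤ m₂ ∨ Valued.v x / Valued.v y ≤ exp (-((j + b : ℕ) - (m₂ : ℤ)))) ↔ j + b + nν ≤ m₂ + jl := by
  have hx' : Valued.v x = exp (-(jl : ℤ)) := by rw [hx, hdα, mul_one, hϖE, ← exp_nsmul, nsmul_eq_mul, mul_neg, mul_one]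
  have hy' : Valued.v y = exp (-(nν : ℤ)) := by rw [hy, hϖE, ← exp_nsmul, nsmul_eq_mul, mul_neg, mul_one]
  have hle : nν ≤ jl := by rw [hx', hy', exp_le_exp] at hxy; omega
  rw [hx', hy', ← exp_sub, exp_le_exp]
  constructor
  · rintro (h | h) <;> omega
  · intro h; right; omega

/-- **THE GUARD IS A CUTOFF, M∕E RAMIFIED TOKENS**: `|ϖE| = exp(−2)`, `|dα| = exp(−d_ρ)`, `|x| = |ϖE|^{jl}|dα|`, `|y| = exp(−kν)`:
`(j + b ≤ m₂ ∨ |x|∕|y| ≤ exp(2m₂ − 2b − 2j − d_ρ)) ⟺ (j + b ≤ m₂ ∨ 2(j+b) + kν ≤ 2m₂ + 2jl)`. [cite: Serre1979, Ch. II §1; Ch. IV §1] -/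
theorem guard_iff_cutoff_ramM {ϖE dα x y : K} (hϖE : Valued.v ϖE = exp (-2 : ℤ)) {dρ : ℕ} (hdα : Valued.v dα = exp (-(dρ : ℤ))) {jl kν : ℕ}
    (hx : Valued.v x = Valued.v ϖE ^ jl * Valued.v dα) (hy : Valued.v y = exp (-(kν : ℤ))) (j b m₂ : ℕ) :
    (j + b ≤ m₂ ∨ Valued.v x / Valued.v y ≤ exp (2 * (m₂ : ℤ) - 2 * b - 2 * j - dρ)) ↔ (j + b ≤ m₂ ∨ 2 * (j + b) + kν ≤ 2 * m₂ + 2 * jl) := by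
  have hx' : Valued.v x = exp (-(2 * (jl : ℤ) + dρ)) := by
    rw [hx, hdα, hϖE, ← exp_nsmul, nsmul_eq_mul, ← exp_add]; congr 1; ring
  rw [hx', hy, ← exp_sub, exp_le_exp]
  constructor
  · rintro (h | h)
    · exact Or.inl h
    · right; omega
  · rintro (h | h)
    · exact Or.inl h
    · right; omega

end Letters

/-! ## §2 The two censuses in cutoff form (branch `m₁ ≤ m₂`) -/

section Unramified

variable {E : Type*} {M : Type} [Field E] [Valued E ℤᵐ⁰] [Field M] [Valued M ℤᵐ⁰] {ρ Θ : M →+* M} {α : M}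

/-- **(T5-P-cut) THE LEVEL-PIECE CENSUS AS A DOUBLY TRUNCATED ONE-MULTIPLIER ORDER FORM — M∕E UNRAMIFIED (types U, RamK), depth multiplier shallower (`m₁ ≤ m₂`, the branch
of a neighbourhood of `1`).**  Frame of ★ p859278 `…_orderForm_guarded` VERBATIM, plus the element's tokens: `jl` (`|lam − ρlam| = |jE ϖ|^{jl}|α − ρα|`), the levels `|jE c| = |jE ϖ|^{a′}`,
`|jE c′| = |jE ϖ|^{b′}` with the level conditions `|lam − 1| ≤ |jE c|`, `|(lam−1)²| ≤ |jE c′|`, `a′ ≤ jl`, `b′ ≤ jl + n`, `n` (`|lam + ρlam − 2| = |jE ϖ|^n`), `nν` (`|lam + jE u₀₀ − 2| = |jE ϖ|^{nν}`).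
Then, with `J′ := min(jl − a′, jl + n − b′)`:  `cnt(lev) = Σ_{j ≤ J′} #levelSet(j,0) + Σ_{b ∈ Icc 1 R} Σ_{j ≤ J′} [j + b + nν ≤ m₂ + jl]·Σᶠ_{Λ ∈ levelSetDep(j,b;μ₁)} f b j Λ` — every summand
truncated at `J′` (★ p859438 §1) and the guard read as the DIAGONAL CUTOFF (★ p859341 GUARD LETTER + §1).
[cite: Kottwitz1986BaseChangeUnits, §1 pp. 240–241] [cite: Jacobowitz1962, §4] [cite: Serre1979, Ch. II §1; Ch. III §6 Prop. 12] [cite: Flicker1998UnitaryFL, Prop. 7 p. 84] -/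
theorem ncard_fixed_selfDual_endoGL_lev_sq_eq_orderForm_cutoff [IsPrincipalIdealRing 𝒪[E]] (σ : E →+* E) (hσ : ∀ a, σ (σ a) = a) (hvσ : ∀ a, Valued.v (σ a) = Valued.v a)
    {ϖ : E} (hϖ : Valued.v ϖ = WithZero.exp (-1 : ℤ))
    {H₂ : Matrix (Fin 2) (Fin 2) E} (hH₂ : IsUnit H₂.det) (hH₂σ : (H₂.map σ)ᵀ = H₂) {hW : E} (hhW : Valued.v hW = 1) (hhWσ : σ hW = hW) (jE : E →+* M)
    (hρρ : ∀ x, ρ (ρ x) = x) (hvρ : ∀ x, Valued.v (ρ x) = Valued.v x) (hα : ρ α ≠ α) (hα1 : Valued.v α ≤ 1)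
    (hint : ∀ z : M, Valued.v z ≤ 1 → Valued.v ((z - ρ z) / (α - ρ α)) ≤ 1)
    (hΘΘ : ∀ x, Θ (Θ x) = x) (hΘρ : ∀ x, Θ (ρ x) = ρ (Θ x)) (hvΘ : ∀ x, Valued.v (Θ x) = Valued.v x) (hΘj : ∀ x, Θ (jE x) = jE (σ x))
    (hjv : ∀ c, Valued.v (jE c) ≤ 1 ↔ Valued.v c ≤ 1) (hjfix : ∀ z, ρ z = z ↔ ∃ c, jE c = z)
    (hjpow : ∀ (t : E) (n : ℤ), Valued.v (jE t) = Valued.v (jE ϖ) ^ n ↔ Valued.v t = Valued.v ϖ ^ n)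
    (hEval : ∀ c : M, ρ c = c → c ≠ 0 → Valued.v c ≤ 1 → ∃ n : ℕ, Valued.v c = Valued.v (jE ϖ) ^ n)
    (hϖmax : ∀ t : M, ρ t = t → Valued.v t < 1 → Valued.v t ≤ Valued.v (jE ϖ))
    (φ : (Fin 2 → E) →+ M) (hφs : ∀ (c : E) (x : Fin 2 → E), φ (c • x) = jE c * φ x) (hφi : Function.Injective φ) (hφo : Function.Surjective φ)
    {γ₂ : GL (Fin 2) E} {lam h : M} (hφγ : ∀ x, φ ((γ₂ : Matrix (Fin 2) (Fin 2) E).mulVec x) = lam * φ x) (hlam : Valued.v lam = 1)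
    (hΘh : Θ h = h) (hh : h ≠ 0) (hform : ∀ x y, jE (pairing σ H₂ x y) = h * Θ (φ x) * φ y + ρ (h * Θ (φ x) * φ y))
    (u : GL (Fin 1) E) (hΓ : endoGL (γ₂, u) ∈ unitaryGroupOfForm σ (!![H₂ 0 0, 0, H₂ 0 1; 0, hW, 0; H₂ 1 0, 0, H₂ 1 1] : Matrix (Fin 3) (Fin 3) E))
    (hu : Valued.v ((u : Matrix (Fin 1) (Fin 1) E) 0 0) = 1) {c c' : E} (hc : c ≠ 0) (hc' : c' ≠ 0) (hc1 : Valued.v c ≤ 1)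
    (huc : Valued.v ((u : Matrix (Fin 1) (Fin 1) E) 0 0 - 1) ≤ Valued.v c) (huc2 : Valued.v (((u : Matrix (Fin 1) (Fin 1) E) 0 0 - 1) ^ 2) ≤ Valued.v c')
    (hαv : Valued.v (α - ρ α) = 1) (hϖM : Valued.v (jE ϖ) = WithZero.exp (-1 : ℤ)) {m₁ m₂ : ℕ}
    (hm₁ : Valued.v ((jE c)⁻¹ * (lam - jE ((u : Matrix (Fin 1) (Fin 1) E) 0 0))) = WithZero.exp (-(m₁ : ℤ)))
    (hm₂ : Valued.v ((jE c')⁻¹ * ((lam - 1) * (lam - 1) - jE (((u : Matrix (Fin 1) (Fin 1) E) 0 0 - 1) ^ 2))) = WithZero.exp (-(m₂ : ℤ))) (hle : m₁ ≤ m₂) {R : ℕ}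
    (hfinF : {L : Submodule 𝒪[E] (Fin 3 → E) |
      IsSelfDualLattice σ ϖ (!![H₂ 0 0, 0, H₂ 0 1; 0, hW, 0; H₂ 1 0, 0, H₂ 1 1] : Matrix (Fin 3) (Fin 3) E) L ∧ mapGL (endoGL (γ₂, u)) L = L}.Finite)
    (hR : ∀ L : Submodule 𝒪[E] (Fin 3 → E), IsSelfDualLattice σ ϖ (!![H₂ 0 0, 0, H₂ 0 1; 0, hW, 0; H₂ 1 0, 0, H₂ 1 1] : Matrix (Fin 3) (Fin 3) E) L →
      mapGL (endoGL (γ₂, u)) L = L → ∀ b : ℕ, (∀ c : E, (Pi.single 1 c : Fin 3 → E) ∈ L ↔ Valued.v c ≤ Valued.v ϖ ^ b) → b ≤ R)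
    {J : ℕ} (hJ : ¬ IsOrd ρ α (jE ϖ ^ (J + 1)) lam) (hfinLS : ∀ j a, (levelSet ρ Θ α (jE ϖ) h j a).Finite)
    (f : ℕ → ℕ → AddSubgroup M → ℕ)
    (hf : ∀ (b j : ℕ) (Λ : AddSubgroup M) (x₀ : M) (r : E), 1 ≤ b → x₀ ≠ 0 →
      (∀ x, x ∈ Λ ↔ ∃ z, IsOrd ρ α (jE ϖ ^ j) z ∧ x = x₀ * z) →
      IsOrd ρ α (jE ϖ ^ j) (dualGen ρ Θ α (jE ϖ ^ j) h x₀) → ¬ IsOrd ρ α (jE ϖ ^ j) (dualGen ρ Θ α (jE ϖ ^ j) h x₀ / jE ϖ) →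
      Valued.v (dualGen ρ Θ α (jE ϖ ^ j) h x₀) = Valued.v (jE ϖ) ^ b →
      (∀ b', (∀ x ∈ Λ, Valued.v (h * Θ x * b' + ρ (h * Θ x * b')) ≤ 1) → (lam - jE ((u : Matrix (Fin 1) (Fin 1) E) 0 0)) * b' ∈ Λ) →
      IsOrd ρ α (jE ϖ ^ j) lam → jE r = glueUnit ρ Θ α (jE ϖ ^ j) h (jE ϖ) (jE hW) x₀ b →
      f b j Λ = Nat.card {x : 𝒪[E] ⧸ 𝓂[E] ^ (2 * b) // ∃ u' : 𝒪[E], Ideal.Quotient.mk (𝓂[E] ^ (2 * b)) u' = x ∧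
        Valued.v ((u' : E) * σ u' - r) ≤ Valued.v (ϖ ^ (2 * b))})
    {jl : ℕ} (hjl : Valued.v (lam - ρ lam) = Valued.v (jE ϖ) ^ jl * Valued.v (α - ρ α))
    {a' : ℕ} (hca : Valued.v (jE c) = Valued.v (jE ϖ) ^ a') (hlev : Valued.v (lam - 1) ≤ Valued.v (jE c)) (hajl : a' ≤ jl)
    {b' : ℕ} (hcb : Valued.v (jE c') = Valued.v (jE ϖ) ^ b') (hlev2 : Valued.v ((lam - 1) * (lam - 1)) ≤ Valued.v (jE c'))
    {n : ℕ} (hn : Valued.v (lam + ρ lam - 2) = Valued.v (jE ϖ) ^ n) (hb : b' ≤ jl + n)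
    {nν : ℕ} (hnν : Valued.v (lam + jE ((u : Matrix (Fin 1) (Fin 1) E) 0 0) - 2) = Valued.v (jE ϖ) ^ nν) :
    {L : Submodule 𝒪[E] (Fin 3 → E) |
        IsSelfDualLattice σ ϖ (!![H₂ 0 0, 0, H₂ 0 1; 0, hW, 0; H₂ 1 0, 0, H₂ 1 1] : Matrix (Fin 3) (Fin 3) E) L ∧ mapGL (endoGL (γ₂, u)) L = L ∧
          L.map ((Matrix.toLin' (((endoGL (γ₂, u) : GL (Fin 3) E) : Matrix (Fin 3) (Fin 3) E) - 1)).restrictScalars 𝒪[E]) ≤ scaleLattice c L ∧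
          L.map ((Matrix.toLin' ((((endoGL (γ₂, u) : GL (Fin 3) E) : Matrix (Fin 3) (Fin 3) E) - 1) *
            (((endoGL (γ₂, u) : GL (Fin 3) E) : Matrix (Fin 3) (Fin 3) E) - 1))).restrictScalars 𝒪[E]) ≤ scaleLattice c' L}.ncard =
      (∑ j ∈ Finset.range (min (jl - a') (jl + n - b') + 1), (levelSet ρ Θ α (jE ϖ) h j 0).ncard) +
        ∑ b ∈ Finset.Icc 1 R, ∑ j ∈ Finset.range (min (jl - a') (jl + n - b') + 1),
          (if j + b + nν ≤ m₂ + jl then ∑ᶠ Λ ∈ levelSetDep ρ Θ α (jE ϖ) h j b ((jE c)⁻¹ * (lam - jE ((u : Matrix (Fin 1) (Fin 1) E) 0 0))), f b j Λ else 0) := by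
  have hϖv : Valued.v (jE ϖ) ≠ 0 := by rw [hϖM]; exact WithZero.exp_ne_zero
  have hϖE0 : jE ϖ ≠ 0 := fun h0 => by rw [h0, map_zero] at hϖv; exact hϖv rfl
  have hϖE1 : Valued.v (jE ϖ) < 1 := by rw [hϖM, ← WithZero.exp_zero, WithZero.exp_lt_exp]; norm_num
  have hρc : ρ (jE c) = jE c := (hjfix _).2 ⟨c, rfl⟩
  have hρc' : ρ (jE c') = jE c' := (hjfix _).2 ⟨c', rfl⟩
  have hρu : ρ (jE ((u : Matrix (Fin 1) (Fin 1) E) 0 0)) = jE ((u : Matrix (Fin 1) (Fin 1) E) 0 0) := (hjfix _).2 ⟨_, rfl⟩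
  have hcE0 : jE c ≠ 0 := (map_ne_zero jE).2 hc
  have hc'E0 : jE c' ≠ 0 := (map_ne_zero jE).2 hc'
  have hjlJ : jl ≤ J := by
    have h' := (isOrd_pow_iff_le hα hϖE0 hϖE1 hlam.le hjl (J + 1)).not.1 hJ
    omega
  have hμ0 : lam - jE ((u : Matrix (Fin 1) (Fin 1) E) 0 0) ≠ 0 := by
    intro h0
    have h1 := hm₁
    rw [h0, mul_zero, map_zero] at h1
    exact WithZero.exp_ne_zero h1.symm
  have hν0 : lam + jE ((u : Matrix (Fin 1) (Fin 1) E) 0 0) - 2 ≠ 0 := fun h0 => by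
    rw [h0, map_zero] at hnν; exact pow_ne_zero nν hϖv hnν.symm
  rw [ncard_fixed_selfDual_endoGL_lev_sq_eq_orderForm_guarded σ hσ hvσ hϖ hH₂ hH₂σ hhW hhWσ jE hρρ hvρ hα hα1 hint hΘΘ hΘρ hvΘ hΘj hjv hjfix hjpow hEval hϖmax φ hφs hφi hφo hφγ hlam hΘh hh hform u hΓ hu hc hc' hc1 huc huc2 hαv hϖM hm₁ hm₂ hle hfinF hR hJ hfinLS f hf]
  congr 1
  · exact sum_ite_isOrd₃_eq_sum_range hα hϖE0 hϖE1 hlam.le hjl hρc hca hlev hajl hρc' hcb hlev2 hn hb hjlJ _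
  · refine Finset.sum_congr rfl fun b _ => ?_
    rw [sum_ite_isOrd₃_eq_sum_range hα hϖE0 hϖE1 hlam.le hjl hρc hca hlev hajl hρc' hcb hlev2 hn hb hjlJ]
    refine Finset.sum_congr rfl fun j _ => ?_
    have hguard : (j + b ≤ m₂ ∨ Valued.v (ρ ((jE c)⁻¹ * (lam - jE ((u : Matrix (Fin 1) (Fin 1) E) 0 0))) / ((jE c)⁻¹ * (lam - jE ((u : Matrix (Fin 1) (Fin 1) E) 0 0))) -
        ρ ((jE c')⁻¹ * ((lam - 1) * (lam - 1) - jE (((u : Matrix (Fin 1) (Fin 1) E) 0 0 - 1) ^ 2))) / ((jE c')⁻¹ * ((lam - 1) * (lam - 1) - jE (((u : Matrix (Fin 1) (Fin 1) E) 0 0 - 1) ^ 2)))) ≤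
          WithZero.exp (-((j + b : ℕ) - (m₂ : ℤ)))) ↔ j + b + nν ≤ m₂ + jl := by
      rw [v_twist_depth_sub_twist_sq_eq hvρ jE hcE0 hc'E0 hρc hρc' hμ0 hν0, add_sub_two_sub_map_eq hρu]
      exact guard_iff_cutoff_unr hϖM hαv hjl hnν (by rw [← add_sub_two_sub_map_eq (ρ := ρ) (lam := lam) hρu]; exact v_sub_map_le hvρ _) j b m₂
    by_cases hcut : j + b + nν ≤ m₂ + jl
    · rw [if_pos (hguard.2 hcut), if_pos hcut]
    · rw [if_neg (fun h' => hcut (hguard.1 h')), if_neg hcut]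

end Unramified

section Ramified

-- `M : Type`: ★ `IsRamifiedQuadraticDatum` and the GUARD LETTER are stated in universe `0`.
variable {E : Type*} {M : Type} [Field E] [Valued E ℤᵐ⁰] [Field M] [Valued M ℤᵐ⁰] {ρ Θ : M →+* M} {α : M}

/-- **(T5-P-cut) THE LEVEL-PIECE CENSUS AS A DOUBLY TRUNCATED ONE-MULTIPLIER ORDER FORM — M∕E RAMIFIED (type RamM), depth multiplier shallower (`m₁ ≤ m₂`).**  Frame of ★ p859305
`…_orderForm_guarded_ramified` VERBATIM (ramified datum `(ρ, α, d_ρ)`, `|jE ϖ| = exp(−2)`), plus the tokens `jl, a′, b′, n` as in the unramified twin and `kν` (`|lam + jE u₀₀ − 2| = exp(−kν)`).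
Then `cnt(lev) = Σ_{j ≤ J′} #levelSet(j,0) + Σ_{b ∈ Icc 1 R} Σ_{j ≤ J′} [j + b ≤ m₂ ∨ 2(j+b) + kν ≤ 2m₂ + 2jl]·Σᶠ_{Λ ∈ levelSetDep(j,b;μ₁)} f b j Λ`, `J′ := min(jl − a′, jl + n − b′)`.
[cite: Kottwitz1986BaseChangeUnits, §1 pp. 240–241] [cite: Jacobowitz1962, §4] [cite: Serre1979, Ch. II §1; Ch. IV §1] [cite: Flicker1998UnitaryFL, Prop. 7 p. 84] -/
theorem ncard_fixed_selfDual_endoGL_lev_sq_eq_orderForm_cutoff_ramified [IsPrincipalIdealRing 𝒪[E]] (σ : E →+* E) (hσ : ∀ a, σ (σ a) = a) (hvσ : ∀ a, Valued.v (σ a) = Valued.v a)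
    {ϖ : E} (hϖ : Valued.v ϖ = WithZero.exp (-1 : ℤ))
    {H₂ : Matrix (Fin 2) (Fin 2) E} (hH₂ : IsUnit H₂.det) (hH₂σ : (H₂.map σ)ᵀ = H₂) {hW : E} (hhW : Valued.v hW = 1) (hhWσ : σ hW = hW) (jE : E →+* M)
    (hρρ : ∀ x, ρ (ρ x) = x) (hvρ : ∀ x, Valued.v (ρ x) = Valued.v x) (hα : ρ α ≠ α) (hα1 : Valued.v α ≤ 1)
    (hint : ∀ z : M, Valued.v z ≤ 1 → Valued.v ((z - ρ z) / (α - ρ α)) ≤ 1)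
    (hΘΘ : ∀ x, Θ (Θ x) = x) (hΘρ : ∀ x, Θ (ρ x) = ρ (Θ x)) (hvΘ : ∀ x, Valued.v (Θ x) = Valued.v x) (hΘj : ∀ x, Θ (jE x) = jE (σ x))
    (hjv : ∀ c, Valued.v (jE c) ≤ 1 ↔ Valued.v c ≤ 1) (hjfix : ∀ z, ρ z = z ↔ ∃ c, jE c = z)
    (hjpow : ∀ (t : E) (n : ℤ), Valued.v (jE t) = Valued.v (jE ϖ) ^ n ↔ Valued.v t = Valued.v ϖ ^ n)
    (hEval : ∀ c : M, ρ c = c → c ≠ 0 → Valued.v c ≤ 1 → ∃ n : ℕ, Valued.v c = Valued.v (jE ϖ) ^ n)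
    (hϖmax : ∀ t : M, ρ t = t → Valued.v t < 1 → Valued.v t ≤ Valued.v (jE ϖ))
    (φ : (Fin 2 → E) →+ M) (hφs : ∀ (c : E) (x : Fin 2 → E), φ (c • x) = jE c * φ x) (hφi : Function.Injective φ) (hφo : Function.Surjective φ)
    {γ₂ : GL (Fin 2) E} {lam h : M} (hφγ : ∀ x, φ ((γ₂ : Matrix (Fin 2) (Fin 2) E).mulVec x) = lam * φ x) (hlam : Valued.v lam = 1)
    (hΘh : Θ h = h) (hh : h ≠ 0) (hform : ∀ x y, jE (pairing σ H₂ x y) = h * Θ (φ x) * φ y + ρ (h * Θ (φ x) * φ y))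
    (u : GL (Fin 1) E) (hΓ : endoGL (γ₂, u) ∈ unitaryGroupOfForm σ (!![H₂ 0 0, 0, H₂ 0 1; 0, hW, 0; H₂ 1 0, 0, H₂ 1 1] : Matrix (Fin 3) (Fin 3) E))
    (hu : Valued.v ((u : Matrix (Fin 1) (Fin 1) E) 0 0) = 1) {c c' : E} (hc : c ≠ 0) (hc' : c' ≠ 0) (hc1 : Valued.v c ≤ 1)
    (huc : Valued.v ((u : Matrix (Fin 1) (Fin 1) E) 0 0 - 1) ≤ Valued.v c) (huc2 : Valued.v (((u : Matrix (Fin 1) (Fin 1) E) 0 0 - 1) ^ 2) ≤ Valued.v c')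
    {dρ tρ : ℕ} (hD : IsRamifiedQuadraticDatum ρ α dρ tρ) (hϖM : Valued.v (jE ϖ) = WithZero.exp (-2 : ℤ)) {m₁ m₂ : ℕ}
    (hm₁ : Valued.v ((jE c)⁻¹ * (lam - jE ((u : Matrix (Fin 1) (Fin 1) E) 0 0))) = Valued.v (jE ϖ) ^ m₁)
    (hm₂ : Valued.v ((jE c')⁻¹ * ((lam - 1) * (lam - 1) - jE (((u : Matrix (Fin 1) (Fin 1) E) 0 0 - 1) ^ 2))) = Valued.v (jE ϖ) ^ m₂) (hle : m₁ ≤ m₂) {R : ℕ}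
    (hfinF : {L : Submodule 𝒪[E] (Fin 3 → E) |
      IsSelfDualLattice σ ϖ (!![H₂ 0 0, 0, H₂ 0 1; 0, hW, 0; H₂ 1 0, 0, H₂ 1 1] : Matrix (Fin 3) (Fin 3) E) L ∧ mapGL (endoGL (γ₂, u)) L = L}.Finite)
    (hR : ∀ L : Submodule 𝒪[E] (Fin 3 → E), IsSelfDualLattice σ ϖ (!![H₂ 0 0, 0, H₂ 0 1; 0, hW, 0; H₂ 1 0, 0, H₂ 1 1] : Matrix (Fin 3) (Fin 3) E) L →
      mapGL (endoGL (γ₂, u)) L = L → ∀ b : ℕ, (∀ c : E, (Pi.single 1 c : Fin 3 → E) ∈ L ↔ Valued.v c ≤ Valued.v ϖ ^ b) → b ≤ R)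
    {J : ℕ} (hJ : ¬ IsOrd ρ α (jE ϖ ^ (J + 1)) lam) (hfinLS : ∀ j a, (levelSet ρ Θ α (jE ϖ) h j a).Finite)
    (f : ℕ → ℕ → AddSubgroup M → ℕ)
    (hf : ∀ (b j : ℕ) (Λ : AddSubgroup M) (x₀ : M) (r : E), 1 ≤ b → x₀ ≠ 0 →
      (∀ x, x ∈ Λ ↔ ∃ z, IsOrd ρ α (jE ϖ ^ j) z ∧ x = x₀ * z) →
      IsOrd ρ α (jE ϖ ^ j) (dualGen ρ Θ α (jE ϖ ^ j) h x₀) → ¬ IsOrd ρ α (jE ϖ ^ j) (dualGen ρ Θ α (jE ϖ ^ j) h x₀ / jE ϖ) →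
      Valued.v (dualGen ρ Θ α (jE ϖ ^ j) h x₀) = Valued.v (jE ϖ) ^ b →
      (∀ b', (∀ x ∈ Λ, Valued.v (h * Θ x * b' + ρ (h * Θ x * b')) ≤ 1) → (lam - jE ((u : Matrix (Fin 1) (Fin 1) E) 0 0)) * b' ∈ Λ) →
      IsOrd ρ α (jE ϖ ^ j) lam → jE r = glueUnit ρ Θ α (jE ϖ ^ j) h (jE ϖ) (jE hW) x₀ b →
      f b j Λ = Nat.card {x : 𝒪[E] ⧸ 𝓂[E] ^ (2 * b) // ∃ u' : 𝒪[E], Ideal.Quotient.mk (𝓂[E] ^ (2 * b)) u' = x ∧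
        Valued.v ((u' : E) * σ u' - r) ≤ Valued.v (ϖ ^ (2 * b))})
    {jl : ℕ} (hjl : Valued.v (lam - ρ lam) = Valued.v (jE ϖ) ^ jl * Valued.v (α - ρ α))
    {a' : ℕ} (hca : Valued.v (jE c) = Valued.v (jE ϖ) ^ a') (hlev : Valued.v (lam - 1) ≤ Valued.v (jE c)) (hajl : a' ≤ jl)
    {b' : ℕ} (hcb : Valued.v (jE c') = Valued.v (jE ϖ) ^ b') (hlev2 : Valued.v ((lam - 1) * (lam - 1)) ≤ Valued.v (jE c'))
    {n : ℕ} (hn : Valued.v (lam + ρ lam - 2) = Valued.v (jE ϖ) ^ n) (hb : b' ≤ jl + n)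
    {kν : ℕ} (hkν : Valued.v (lam + jE ((u : Matrix (Fin 1) (Fin 1) E) 0 0) - 2) = WithZero.exp (-(kν : ℤ))) :
    {L : Submodule 𝒪[E] (Fin 3 → E) |
        IsSelfDualLattice σ ϖ (!![H₂ 0 0, 0, H₂ 0 1; 0, hW, 0; H₂ 1 0, 0, H₂ 1 1] : Matrix (Fin 3) (Fin 3) E) L ∧ mapGL (endoGL (γ₂, u)) L = L ∧
          L.map ((Matrix.toLin' (((endoGL (γ₂, u) : GL (Fin 3) E) : Matrix (Fin 3) (Fin 3) E) - 1)).restrictScalars 𝒪[E]) ≤ scaleLattice c L ∧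
          L.map ((Matrix.toLin' ((((endoGL (γ₂, u) : GL (Fin 3) E) : Matrix (Fin 3) (Fin 3) E) - 1) *
            (((endoGL (γ₂, u) : GL (Fin 3) E) : Matrix (Fin 3) (Fin 3) E) - 1))).restrictScalars 𝒪[E]) ≤ scaleLattice c' L}.ncard =
      (∑ j ∈ Finset.range (min (jl - a') (jl + n - b') + 1), (levelSet ρ Θ α (jE ϖ) h j 0).ncard) +
        ∑ b ∈ Finset.Icc 1 R, ∑ j ∈ Finset.range (min (jl - a') (jl + n - b') + 1),
          (if j + b ≤ m₂ ∨ 2 * (j + b) + kν ≤ 2 * m₂ + 2 * jl then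
            ∑ᶠ Λ ∈ levelSetDep ρ Θ α (jE ϖ) h j b ((jE c)⁻¹ * (lam - jE ((u : Matrix (Fin 1) (Fin 1) E) 0 0))), f b j Λ else 0) := by
  have hϖv : Valued.v (jE ϖ) ≠ 0 := by rw [hϖM]; exact WithZero.exp_ne_zero
  have hϖE0 : jE ϖ ≠ 0 := fun h0 => by rw [h0, map_zero] at hϖv; exact hϖv rfl
  have hϖE1 : Valued.v (jE ϖ) < 1 := by rw [hϖM, ← WithZero.exp_zero, WithZero.exp_lt_exp]; norm_num
  have hρc : ρ (jE c) = jE c := (hjfix _).2 ⟨c, rfl⟩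
  have hρc' : ρ (jE c') = jE c' := (hjfix _).2 ⟨c', rfl⟩
  have hρu : ρ (jE ((u : Matrix (Fin 1) (Fin 1) E) 0 0)) = jE ((u : Matrix (Fin 1) (Fin 1) E) 0 0) := (hjfix _).2 ⟨_, rfl⟩
  have hcE0 : jE c ≠ 0 := (map_ne_zero jE).2 hc
  have hc'E0 : jE c' ≠ 0 := (map_ne_zero jE).2 hc'
  have hjlJ : jl ≤ J := by
    have h' := (isOrd_pow_iff_le hα hϖE0 hϖE1 hlam.le hjl (J + 1)).not.1 hJ
    omega
  have hμ0 : lam - jE ((u : Matrix (Fin 1) (Fin 1) E) 0 0) ≠ 0 := by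
    intro h0
    have h1 := hm₁
    rw [h0, mul_zero, map_zero] at h1
    exact pow_ne_zero m₁ hϖv h1.symm
  have hν0 : lam + jE ((u : Matrix (Fin 1) (Fin 1) E) 0 0) - 2 ≠ 0 := fun h0 => by
    rw [h0, map_zero] at hkν; exact WithZero.exp_ne_zero hkν.symm
  rw [ncard_fixed_selfDual_endoGL_lev_sq_eq_orderForm_guarded_ramified σ hσ hvσ hϖ hH₂ hH₂σ hhW hhWσ jE hρρ hvρ hα hα1 hint hΘΘ hΘρ hvΘ hΘj hjv hjfix hjpow hEval hϖmax φ hφs hφi hφo hφγ hlam hΘh hh hform u hΓ hu hc hc' hc1 huc huc2 hD hϖM hm₁ hm₂ hle hfinF hR hJ hfinLS f hf]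
  congr 1
  · exact sum_ite_isOrd₃_eq_sum_range hα hϖE0 hϖE1 hlam.le hjl hρc hca hlev hajl hρc' hcb hlev2 hn hb hjlJ _
  · refine Finset.sum_congr rfl fun b _ => ?_
    rw [sum_ite_isOrd₃_eq_sum_range hα hϖE0 hϖE1 hlam.le hjl hρc hca hlev hajl hρc' hcb hlev2 hn hb hjlJ]
    refine Finset.sum_congr rfl fun j _ => ?_
    have hguard : (j + b ≤ m₂ ∨ Valued.v (ρ ((jE c)⁻¹ * (lam - jE ((u : Matrix (Fin 1) (Fin 1) E) 0 0))) / ((jE c)⁻¹ * (lam - jE ((u : Matrix (Fin 1) (Fin 1) E) 0 0))) -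
        ρ ((jE c')⁻¹ * ((lam - 1) * (lam - 1) - jE (((u : Matrix (Fin 1) (Fin 1) E) 0 0 - 1) ^ 2))) / ((jE c')⁻¹ * ((lam - 1) * (lam - 1) - jE (((u : Matrix (Fin 1) (Fin 1) E) 0 0 - 1) ^ 2)))) ≤
          WithZero.exp (2 * (m₂ : ℤ) - 2 * b - 2 * j - dρ)) ↔ (j + b ≤ m₂ ∨ 2 * (j + b) + kν ≤ 2 * m₂ + 2 * jl) := by
      rw [v_twist_depth_sub_twist_sq_eq hvρ jE hcE0 hc'E0 hρc hρc' hμ0 hν0, add_sub_two_sub_map_eq hρu]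
      exact guard_iff_cutoff_ramM hϖM (v_sub_map_eq_exp_of_datum hD) hjl hkν j b m₂
    by_cases hcut : j + b ≤ m₂ ∨ 2 * (j + b) + kν ≤ 2 * m₂ + 2 * jl
    · rw [if_pos (hguard.2 hcut), if_pos hcut]
    · rw [if_neg (fun h' => hcut (hguard.1 h')), if_neg hcut]

end Ramified

end Summit.HodgeConjecture.HodgeConjecture.Cruxes.H413.F0P3cDyRamJointProfileCensusCutoff

end
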